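import Summits.HubbardSuperconductivity.HubbardSuperconductivity.Theorems.GibbsMajorantLemma
import Literature.MathematicalPhysics.QuantumLattice.TracePowerInequalities
import Mathlib.Analysis.MeanInequalitiesPow

/-!
# Route `GibbsMajorant`: the support item `TimeChessboard` (stmt-HubbardSuperconductivity-15721)

TIME CHESSBOARD (Hölder for Schatten norms, i.e. reflection positivity in imaginary time, valid for
EVERY Hermitian `H`): for PSD `X`, real `β` and `k ≥ 1`,
`(Re Tr(e^{-βH}X))^{2k} ≤ Re Tr((X e^{-βH/k} X)^k) · (Re Tr e^{-βH})^{2k−1}`.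

Proof (finite-dimensional, by two Jensen inequalities instead of the general trace Hölder
inequality).  In the eigenbasis `H = U diag(λ) Uᴴ` put `Y = UᴴXU ⪰ 0`, `y_i = Y_ii ≥ 0`,
`t_i = e^{-βλ_i/(2k)}`, `Z = Σ_i t_i^{2k} = Tr e^{-βH}`.  Then `Tr(e^{-βH}X) = Σ_i t_i^{2k} y_i` and, by
the power-mean (Jensen) inequality with weights `t_i^{2k}/Z`,
`(Σ_i t_i^{2k} y_i)^{2k} ≤ Z^{2k−1} Σ_i t_i^{2k} y_i^{2k}`.  On the other side
`Tr((X e^{-βH/k} X)^k) = Tr(M^k)` with `M = D Y² D = (YD)ᴴ(YD) ⪰ 0`, `D = diag(t)` (cyclicity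
`Tr((AB)^k) = Tr((BA)^k)`, the tree's `trace_mul_pow_swap`), and `M_ii = t_i² Σ_j |Y_ij|² ≥ t_i² y_i²`, while Jensen on the spectral
measure of `M` at `e_i` gives `(M^k)_ii ≥ (M_ii)^k ≥ t_i^{2k} y_i^{2k}`; summing over `i` closes the
chain.  Dyson–Lieb–Simon, J. Stat. Phys. 18 (1978) §3; Fröhlich–Israel–Lieb–Simon, CMP 62 (1978);
Friedli–Velenik (2017) (10.24)–(10.26).  No definition is introduced.
-/

set_option linter.dupNamespace false

noncomputable section

open scoped Matrix.Norms.L2Operator ComplexOrder MatrixOrder ComplexConjugate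
open Matrix Finset Literature.MathematicalPhysics.QuantumLattice

namespace Summit.HubbardSuperconductivity.HubbardSuperconductivity.Theorems.GibbsMajorant

variable {n : Type*} [Fintype n] [DecidableEq n]

/-! ### Conjugated diagonal matrices: entries and powers -/

/-- Diagonal entries of a conjugated diagonal matrix: `(U diag(d) Uᴴ)_ii = Σ_j d_j |U_ij|²`. [folklore] -/
theorem conj_diagonal_apply_self (U : Matrix n n ℂ) (d : n → ℂ) (i : n) :
    (U * diagonal d * Uᴴ) i i = ∑ j, d j * ((‖U i j‖ ^ 2 : ℝ) : ℂ) := by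
  rw [mul_apply]
  refine Finset.sum_congr rfl fun j _ => ?_
  rw [mul_diagonal, conjTranspose_apply, Complex.star_def, Complex.ofReal_pow, ← Complex.mul_conj']
  ring

/-- The rows of `U` are unit vectors when `U Uᴴ = 1`: `Σ_j |U_ij|² = 1`. [folklore] -/
theorem sum_norm_sq_row_eq_one (U : Matrix n n ℂ) (hU : U * Uᴴ = 1) (i : n) :
    ∑ j, ‖U i j‖ ^ 2 = 1 := by
  have h := conj_diagonal_apply_self U (fun _ => (1 : ℂ)) i
  rw [diagonal_one, Matrix.mul_one, hU, one_apply_eq] at h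
  simp only [one_mul] at h
  exact_mod_cast h.symm

/-- Powers of a conjugated diagonal matrix (`Uᴴ U = 1`): `(U diag(d) Uᴴ)^(k+1) = U diag(d^(k+1)) Uᴴ`. [folklore] -/
theorem conj_diagonal_pow_succ (U : Matrix n n ℂ) (hU : Uᴴ * U = 1) (d : n → ℂ) (k : ℕ) :
    (U * diagonal d * Uᴴ) ^ (k + 1) = U * diagonal (fun j => d j ^ (k + 1)) * Uᴴ := by
  induction k with
  | zero => simp only [zero_add, pow_one]
  | succ k ih =>
    rw [pow_succ, ih,
      show U * diagonal (fun j => d j ^ (k + 1)) * Uᴴ * (U * diagonal d * Uᴴ) =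
        U * diagonal (fun j => d j ^ (k + 1)) * (Uᴴ * U) * diagonal d * Uᴴ by
          simp only [Matrix.mul_assoc],
      hU, Matrix.mul_one, Matrix.mul_assoc U (diagonal _) (diagonal d), diagonal_mul_diagonal]
    rfl

/-! ### Jensen on the spectral measure: `(M^k)_ii ≥ (M_ii)^k` for `M ⪰ 0` -/

/-- **Diagonal entries of powers of a PSD matrix**: `((M_ii).re)^(k+1) ≤ ((M^(k+1))_ii).re`
(Jensen for `x ↦ x^(k+1)` on the spectral measure of `M` at `e_i`). [folklore] -/
theorem pow_re_apply_self_le_re_pow_apply_self {M : Matrix n n ℂ} (hM : M.PosSemidef) (i : n)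
    (k : ℕ) : ((M i i).re) ^ (k + 1) ≤ ((M ^ (k + 1)) i i).re := by
  set V : Matrix n n ℂ := (hM.1.eigenvectorUnitary : Matrix n n ℂ) with hV
  have hM' : M = V * diagonal (fun j => ((hM.1.eigenvalues j : ℝ) : ℂ)) * Vᴴ :=
    eq_conj_diagonal_eigenvalues hM.1
  have hVV : Vᴴ * V = 1 := conjTranspose_eigenvectorUnitary_mul_self hM.1
  have hVV' : V * Vᴴ = 1 := eigenvectorUnitary_mul_conjTranspose_self hM.1
  have hpow : M ^ (k + 1) =
      V * diagonal (fun j => (((hM.1.eigenvalues j : ℝ) : ℂ)) ^ (k + 1)) * Vᴴ := by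
    conv_lhs => rw [hM']
    rw [conj_diagonal_pow_succ V hVV]
  have h1 : (M i i).re = ∑ j, ‖V i j‖ ^ 2 * hM.1.eigenvalues j := by
    conv_lhs => rw [hM']
    rw [conj_diagonal_apply_self, Complex.re_sum]
    refine Finset.sum_congr rfl fun j _ => ?_
    rw [← Complex.ofReal_mul, Complex.ofReal_re, mul_comm]
  have h2 : ((M ^ (k + 1)) i i).re = ∑ j, ‖V i j‖ ^ 2 * hM.1.eigenvalues j ^ (k + 1) := by
    rw [hpow, conj_diagonal_apply_self, Complex.re_sum]
    refine Finset.sum_congr rfl fun j _ => ?_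
    rw [← Complex.ofReal_pow, ← Complex.ofReal_mul, Complex.ofReal_re, mul_comm]
  rw [h1, h2]
  exact Real.pow_arith_mean_le_arith_mean_pow Finset.univ (fun j => ‖V i j‖ ^ 2)
    (fun j => hM.1.eigenvalues j) (fun j _ => sq_nonneg _) (sum_norm_sq_row_eq_one V hVV' i)
    (fun j _ => hM.eigenvalues_nonneg j) (k + 1)

/-! ### The time chessboard estimate -/

/-- **`TimeChessboard` holds** (route `GibbsMajorant`, item `stmt-HubbardSuperconductivity-15721`):
for Hermitian `H`, PSD `X`, real `β` and `k ≥ 1`,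
`(Re Tr(e^{-βH}X))^{2k} ≤ Re Tr((X e^{-βH/k} X)^k) · (Re Tr e^{-βH})^{2k−1}` — Hölder for Schatten
`2k`-norms in the special configuration `Tr((XT)·T^{2k−1})`, `T = e^{-βH/(2k)}`, proved by two Jensen
inequalities (power means with the Boltzmann weights; diagonal entries of powers of the PSD matrix
`(YD)ᴴ(YD)`). Dyson–Lieb–Simon (1978) §3; Friedli–Velenik (2017) (10.24)–(10.26). [folklore] -/
theorem timeChessboard_proof :
    Summit.HubbardSuperconductivity.HubbardSuperconductivity.Theses.GibbsMajorant.TimeChessboard := by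
  unfold Summit.HubbardSuperconductivity.HubbardSuperconductivity.Theses.GibbsMajorant.TimeChessboard
  intro m _ _ H X β k hH hX hk
  obtain ⟨j, rfl⟩ : ∃ j, k = j + 1 := ⟨k - 1, by omega⟩
  rcases isEmpty_or_nonempty m with hm | hm
  · -- empty index type: all traces vanish
    have h0 : ∀ A : Matrix m m ℂ, A.trace = 0 := fun A => by simp [Matrix.trace]
    simp only [h0, Complex.zero_re]
    rw [zero_pow (by omega), zero_pow (by omega), mul_zero]
  -- the eigenbasis of `H`
  set U : Matrix m m ℂ := (hH.eigenvectorUnitary : Matrix m m ℂ) with hU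
  have hUU : Uᴴ * U = 1 := conjTranspose_eigenvectorUnitary_mul_self hH
  have hUU' : U * Uᴴ = 1 := eigenvectorUnitary_mul_conjTranspose_self hH
  set lam : m → ℝ := hH.eigenvalues with hlam
  -- `Y = Uᴴ X U ⪰ 0`, `y_i = Y_ii ≥ 0`
  set Y : Matrix m m ℂ := Uᴴ * X * U with hY
  have hYpsd : Y.PosSemidef := hX.conjTranspose_mul_mul_same U
  have hYh : Y.IsHermitian := hYpsd.1
  set y : m → ℝ := fun i => (Y i i).re with hy
  have hYii : ∀ i, Y i i = (y i : ℂ) := by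
    intro i
    have h := Complex.nonneg_iff.mp (hYpsd.diag_nonneg (i := i))
    exact Complex.ext (by simp [hy]) (by rw [Complex.ofReal_im]; exact h.2.symm)
  have hy0 : ∀ i, 0 ≤ y i := fun i => (Complex.nonneg_iff.mp (hYpsd.diag_nonneg (i := i))).1
  -- (1) the one-slice trace and the partition function in the eigenbasis
  have hLHS : (Matrix.trace (gibbsWeight β H * X)).re = ∑ i, Real.exp (-β * lam i) * y i := by
    rw [trace_gibbsWeight_mul_eq_sum hH β X, star_eq_conjTranspose, Complex.re_sum]
    refine Finset.sum_congr rfl fun i _ => ?_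
    rw [show ((hH.eigenvectorUnitary : Matrix m m ℂ))ᴴ * X * (hH.eigenvectorUnitary : Matrix m m ℂ)
        = Y from rfl, hYii, ← Complex.ofReal_mul, Complex.ofReal_re]
  have hZ : (Matrix.trace (gibbsWeight β H)).re = ∑ i, Real.exp (-β * lam i) := by
    rw [show (gibbsWeight β H).trace = partitionFn β H from rfl, partitionFn_eq_sum_exp β hH,
      Complex.re_sum]
    refine Finset.sum_congr rfl fun i _ => ?_
    rw [Complex.ofReal_re]
  set Z : ℝ := ∑ i, Real.exp (-β * lam i) with hZdef
  have hZpos : 0 < Z := Finset.sum_pos (fun i _ => Real.exp_pos _) Finset.univ_nonempty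
  -- (2) Jensen #1 (power means with the Boltzmann weights)
  have hJ1 : (∑ i, Real.exp (-β * lam i) * y i) ^ (2 * (j + 1)) ≤
      Z ^ (2 * (j + 1) - 1) * ∑ i, Real.exp (-β * lam i) * y i ^ (2 * (j + 1)) := by
    set w : m → ℝ := fun i => Real.exp (-β * lam i) / Z with hw
    have hw0 : ∀ i ∈ Finset.univ, 0 ≤ w i := fun i _ => div_nonneg (Real.exp_pos _).le hZpos.le
    have hw1 : ∑ i, w i = 1 := by
      rw [hw, ← Finset.sum_div, div_self hZpos.ne']
    have hJ := Real.pow_arith_mean_le_arith_mean_pow Finset.univ w y hw0 hw1 (fun i _ => hy0 i)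
      (2 * (j + 1))
    have hsum : ∑ i, Real.exp (-β * lam i) * y i = Z * ∑ i, w i * y i := by
      rw [Finset.mul_sum]
      refine Finset.sum_congr rfl fun i _ => ?_
      rw [hw, ← mul_assoc, mul_div_cancel₀ _ hZpos.ne']
    have hsum2 : Z ^ (2 * (j + 1) - 1) * ∑ i, Real.exp (-β * lam i) * y i ^ (2 * (j + 1)) =
        Z ^ (2 * (j + 1)) * ∑ i, w i * y i ^ (2 * (j + 1)) := by
      rw [show 2 * (j + 1) = (2 * (j + 1) - 1) + 1 by omega, pow_succ, Nat.add_sub_cancel, mul_assoc,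
        Finset.mul_sum Finset.univ (fun i => w i * y i ^ (2 * (j + 1) - 1 + 1)) Z]
      congr 1
      refine Finset.sum_congr rfl fun i _ => ?_
      rw [hw, ← mul_assoc, mul_div_cancel₀ _ hZpos.ne']
    rw [hsum, mul_pow, hsum2]
    exact mul_le_mul_of_nonneg_left hJ (pow_nonneg hZpos.le _)
  -- (3) the `k`-slice trace: `Tr((X e^{-βH/k} X)^k) = Tr(M^k)`, `M = D Y² D`
  set s : m → ℝ := fun i => Real.exp (-(β * lam i) / (2 * ((j + 1 : ℕ) : ℝ))) with hs
  have hk0 : ((j + 1 : ℕ) : ℝ) ≠ 0 := by positivity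
  have hss : ∀ i, s i * s i = Real.exp (-(β / ((j + 1 : ℕ) : ℝ)) * lam i) := by
    intro i
    rw [hs, ← Real.exp_add]
    congr 1
    field_simp
    ring
  have hs2k : ∀ i, (s i * s i) ^ (j + 1) = Real.exp (-β * lam i) := by
    intro i
    rw [← pow_two, ← pow_mul, hs, ← Real.exp_nat_mul]
    congr 1
    push_cast
    field_simp
  set D : Matrix m m ℂ := diagonal (fun i => (s i : ℂ)) with hD
  have hDh : Dᴴ = D := by
    rw [hD, diagonal_conjTranspose]
    congr 1
    funext i
    exact Complex.conj_ofReal _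
  have hG : gibbsWeight (β / ((j + 1 : ℕ) : ℝ)) H = U * (D * D) * Uᴴ := by
    have hfun : (fun i => ((Real.exp (-(β / ((j + 1 : ℕ) : ℝ)) * hH.eigenvalues i) : ℝ) : ℂ)) =
        fun i => (s i : ℂ) * (s i : ℂ) := by
      funext i
      rw [← Complex.ofReal_mul, hss]
    rw [gibbsWeight_eq_conj_diagonal' hH, ← hU, hD, diagonal_mul_diagonal, hfun]
  set M : Matrix m m ℂ := D * (Y * Y) * D with hMdef
  have hYY : Y * Y = Uᴴ * (X * X) * U := by
    rw [hY]
    simp only [Matrix.mul_assoc]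
    rw [← Matrix.mul_assoc U Uᴴ (X * U), hUU', Matrix.one_mul]
  have htr : ((X * gibbsWeight (β / ((j + 1 : ℕ) : ℝ)) H * X) ^ (j + 1)).trace = (M ^ (j + 1)).trace := by
    have hAB : X * gibbsWeight (β / ((j + 1 : ℕ) : ℝ)) H * X = (X * U * D) * (D * Uᴴ * X) := by
      rw [hG]; simp only [Matrix.mul_assoc]
    have hBA : (D * Uᴴ * X) * (X * U * D) = M := by
      rw [hMdef, hYY]; simp only [Matrix.mul_assoc]
    rw [hAB, trace_mul_pow_swap, hBA]
  have hMpsd : M.PosSemidef := by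
    have h : M = (Y * D)ᴴ * (Y * D) := by
      rw [conjTranspose_mul, hDh, hYh.eq, hMdef]
      simp only [Matrix.mul_assoc]
    rw [h]
    exact posSemidef_conjTranspose_mul_self _
  -- (4) diagonal entries of `M`: `(M_ii).re = s_i² Σ_j |Y_ij|² ≥ s_i² y_i²`
  have hMii : ∀ i, Real.exp (-β * lam i) * y i ^ (2 * (j + 1)) ≤ ((M ^ (j + 1)) i i).re := by
    intro i
    have hre : (M i i).re = s i * s i * ∑ l, ‖Y i l‖ ^ 2 := by
      rw [hMdef, mul_diagonal, diagonal_mul, mul_apply]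
      have hl : ∀ l, Y i l * Y l i = ((‖Y i l‖ ^ 2 : ℝ) : ℂ) := by
        intro l
        rw [← hYh.apply l i, Complex.star_def, Complex.mul_conj', Complex.ofReal_pow]
      simp_rw [hl]
      rw [← Complex.ofReal_sum]
      simp only [Complex.mul_re, Complex.ofReal_re, Complex.ofReal_im, mul_zero, sub_zero]
      ring
    have hge : s i * s i * y i ^ 2 ≤ (M i i).re := by
      rw [hre]
      refine mul_le_mul_of_nonneg_left ?_ (mul_self_nonneg _)
      have hyi : y i ^ 2 = ‖Y i i‖ ^ 2 := by
        rw [hYii, Complex.norm_real, Real.norm_eq_abs, sq_abs]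
      rw [hyi]
      exact Finset.single_le_sum (f := fun l => ‖Y i l‖ ^ 2) (fun l _ => sq_nonneg _)
        (Finset.mem_univ i)
    have hJ2 := pow_re_apply_self_le_re_pow_apply_self hMpsd i j
    calc Real.exp (-β * lam i) * y i ^ (2 * (j + 1))
        = (s i * s i * y i ^ 2) ^ (j + 1) := by
          rw [mul_pow, hs2k, ← pow_mul]
      _ ≤ ((M i i).re) ^ (j + 1) :=
          pow_le_pow_left₀ (mul_nonneg (mul_self_nonneg _) (sq_nonneg _)) hge _
      _ ≤ ((M ^ (j + 1)) i i).re := hJ2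
  have hsumM : ∑ i, Real.exp (-β * lam i) * y i ^ (2 * (j + 1)) ≤ ((M ^ (j + 1)).trace).re := by
    rw [Matrix.trace, Complex.re_sum]
    exact Finset.sum_le_sum fun i _ => hMii i
  -- (5) assemble
  rw [hLHS, hZ, htr]
  calc (∑ i, Real.exp (-β * lam i) * y i) ^ (2 * (j + 1))
      ≤ Z ^ (2 * (j + 1) - 1) * ∑ i, Real.exp (-β * lam i) * y i ^ (2 * (j + 1)) := hJ1
    _ ≤ Z ^ (2 * (j + 1) - 1) * ((M ^ (j + 1)).trace).re :=
        mul_le_mul_of_nonneg_left hsumM (pow_nonneg hZpos.le _)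
    _ = ((M ^ (j + 1)).trace).re * Z ^ (2 * (j + 1) - 1) := mul_comm _ _

end Summit.HubbardSuperconductivity.HubbardSuperconductivity.Theorems.GibbsMajorant
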